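import Mathlib.RingTheory.PowerSeries.Evaluation
import Mathlib.RingTheory.PowerSeries.PiTopology
import Mathlib.Topology.UniformSpace.DiscreteUniformity
import Mathlib.Topology.Algebra.IsUniformGroup.Constructions
import Mathlib.RingTheory.MvPowerSeries.LinearTopology
import Literature.NumberTheory.EllipticCurves.DeShalit1987.KatzMeasureUnitTwistRing
import HarnessLib

/-!
# Two-variable substitutions of `Λ₂(R) = R⟦T₂⟧⟦T₁⟧`, part I: outer substitutions `F(T₁,T₂) ↦ F(P,T₁)`,
# the swap `T₁ ↔ T₂`, and uniqueness of continuous ring homomorphisms out of `R⟦T₂⟧⟦T₁⟧`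
# (line `thin_comb` v3 on the WALL `AdditiveSplitIMCInclusionAtThree`, stmt-BirchSwinnertonDyer-20395; helper for
# `stub_descent`, `--supports`; cell `pub/bsd-wall`, lead `cruxlead-20395` g3)

WHY. `stub_descent` (v3) of `Cruxes/AdditiveSplitIMCInclusionAtThree/Lines/thin_comb.lean` specialises the
two-variable characteristic ideal `ch_{Λ₂}(X₂) = (g)` along the anticyclotomic line
`𝔞_k = (T₂ − ((1+T₁)^{3^k} − 1))` of a 𝔭-adapted frame, while the tree's specialisation machinery
(`SignedBaseChangeAcDivSpecialization.S2`, `PrintCf2.TwoVarSpecializationFinite`, `XGr₂.toXAc`) is written for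
the ideal `(T₁)` (`PowerSeries.constantCoeff`). This file supplies the change of variables that carries one to
the other, for ANY commutative coefficient ring `R` (used at `ℤ₃` for the module and at `R₀` for the series).
THIS FILE (part I): `substOuter P` (`F(T₁,T₂) ↦ F(P, T₁)`, for `P` with zero total constant term), built by
Mathlib's topological evaluation `PowerSeries.eval₂Hom` for the product topologies over the DISCRETE coefficient
ring — the topological instances are LOCAL to this file and every exported statement is purely algebraic —; its
values `substOuter_X/_C/_C_X/_C_C`; continuity of the tree's (topology-free) swap `T₁ ↔ T₂`
`IntSeries.transpose` / `IntSeries.transposeRingEquiv` (`DeShalit1987/KatzMeasureUnitTwistRing.lean` — reused, not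
re-defined: review of p698075) for the product topology; and the uniqueness of continuous ring homomorphisms out of
`A⟦X⟧` / `R⟦T₂⟧⟦T₁⟧` (`ringHom_ext_of_continuous`, `ringHom_ext₂_of_continuous`: density of polynomials, Mathlib
`PowerSeries.eval₂_unique`), which drives every identity of part II (`…DescentShear.lean`: the shear `α_e`, its
inverse, and the specialisation `φ_e`).

Pure commutative algebra (Bourbaki, Algèbre IV §4 no. 3); nothing about elliptic curves; BSD is not proved by any of
this. References: [Washington1997] §7.1, §13.2 (`ℤ_p⟦Γ⟧ ≅ ℤ_p⟦T⟧`, changes of generator); Bourbaki A IV §4.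
-/

set_option linter.dupNamespace false
set_option autoImplicit false

noncomputable section

namespace Summit.BirchSwinnertonDyer.BirchSwinnertonDyer.Theorems.UniversalToricDescentThinComb.TwoVarSubst

open PowerSeries Literature.NumberTheory.EllipticCurves

variable {R : Type*} [CommRing R]

/-- `T ↦ T₁`: a one-variable series read in the OUTER variable of `R⟦T₂⟧⟦T₁⟧` (its coefficients become
constants). [folklore] -/
abbrev toOuter : PowerSeries R →+* PowerSeries (PowerSeries R) := PowerSeries.map (PowerSeries.C (R := R))

/-- `toOuter T = T₁`. [folklore] -/
theorem toOuter_X : toOuter (R := R) X = X := PowerSeries.map_X _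

/-- `toOuter c = c` on constants. [folklore] -/
theorem toOuter_C (c : R) : toOuter (R := R) (C c) = C (C c) := PowerSeries.map_C _ _

section Topology

/-! ### Local topology: `R` discrete, product topologies on `R⟦T⟧` and `R⟦T₂⟧⟦T₁⟧`

All topological instances below are LOCAL to this section; the exported definitions and theorems are purely
algebraic. -/

/-- LOCAL: the discrete uniformity on the coefficient ring `R` (never exported). -/
local instance instUniformSpaceDiscrete : UniformSpace R := ⊥

/-- LOCAL: `⊥` is the discrete uniformity. -/
local instance instDiscreteUniformityDiscrete : DiscreteUniformity R := by
  change @DiscreteUniformity R ⊥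
  infer_instance

open PowerSeries.WithPiTopology MvPowerSeries.WithPiTopology

/-- Uniqueness of continuous ring homomorphisms out of `A⟦X⟧`: they are determined by their values on
`X` and on the constants (density of polynomials). [folklore] -/
theorem ringHom_ext_of_continuous {A : Type*} [CommRing A] [UniformSpace A] [IsUniformAddGroup A]
    [IsTopologicalRing A] {T : Type*} [CommRing T] [UniformSpace T] [IsUniformAddGroup T]
    [IsTopologicalRing T] [IsLinearTopology T T] [T2Space T] [CompleteSpace T]
    {δ₁ δ₂ : PowerSeries A →+* T} (h₁ : Continuous δ₁) (h₂ : Continuous δ₂)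
    (hX : δ₁ X = δ₂ X) (hC : ∀ a : A, δ₁ (C a) = δ₂ (C a)) : δ₁ = δ₂ := by
  have hcomp : δ₁.comp (C : A →+* PowerSeries A) = δ₂.comp C := RingHom.ext hC
  have key : ∀ (δ : PowerSeries A →+* T), Continuous δ →
      (δ : PowerSeries A → T) = PowerSeries.eval₂ (δ.comp C) (δ X) := by
    intro δ hδ
    have hφ : Continuous (δ.comp (C : A →+* PowerSeries A)) :=
      hδ.comp PowerSeries.WithPiTopology.continuous_C
    have ha : PowerSeries.HasEval (δ X) :=
      IsTopologicallyNilpotent.map hδ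
        (PowerSeries.WithPiTopology.isTopologicallyNilpotent_of_constantCoeff_zero
          (PowerSeries.constantCoeff_X (R := A)))
    refine PowerSeries.eval₂_unique hφ ha hδ fun q => ?_
    have hq : (δ.comp (Polynomial.coeToPowerSeries.ringHom (R := A))) =
        Polynomial.eval₂RingHom (δ.comp C) (δ X) :=
      Polynomial.ringHom_ext (fun a => by simp [Polynomial.coe_C]) (by simp [Polynomial.coe_X])
    have := congrArg (fun g : Polynomial A →+* T => g q) hq
    simpa [Polynomial.coeToPowerSeries.ringHom_apply] using this
  refine RingHom.ext fun F => ?_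
  have e₁ := congrFun (key δ₁ h₁) F
  have e₂ := congrFun (key δ₂ h₂) F
  rw [e₁, e₂, hcomp, hX]

/-- `T ↦ T₁` is continuous (coefficientwise it is `C ∘ coeff`). [folklore] -/
theorem continuous_toOuter : Continuous (toOuter (R := R)) := by
  refine continuous_pi fun d => ?_
  have hd : d = Finsupp.single () (d ()) := Finsupp.unique_single d
  have h : (fun f : PowerSeries R => (toOuter f : PowerSeries (PowerSeries R)) d) =
      fun f => PowerSeries.C (PowerSeries.coeff (d ()) f) := by
    funext f
    conv_lhs => rw [hd]
    change PowerSeries.coeff (d ()) (PowerSeries.map (PowerSeries.C (R := R)) f) = _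
    rw [PowerSeries.coeff_map]
  rw [h]
  exact PowerSeries.WithPiTopology.continuous_C.comp (PowerSeries.WithPiTopology.continuous_coeff R (d ()))

/-- `PowerSeries.map τ` is continuous for the product topologies (coefficientwise it is `τ ∘ coeff`),
for any `τ` continuous on coefficients. [folklore] -/
theorem continuous_map {A B : Type*} [CommRing A] [CommRing B] [TopologicalSpace A] [TopologicalSpace B]
    (τ : A →+* B) (hτ : Continuous τ) : Continuous (PowerSeries.map τ : PowerSeries A → PowerSeries B) := by
  refine continuous_pi fun d => ?_
  have hd : d = Finsupp.single () (d ()) := Finsupp.unique_single d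
  have h : (fun f : PowerSeries A => (PowerSeries.map τ f : PowerSeries B) d) =
      fun f => τ (PowerSeries.coeff (d ()) f) := by
    funext f
    conv_lhs => rw [hd]
    change PowerSeries.coeff (d ()) (PowerSeries.map τ f) = _
    rw [PowerSeries.coeff_map]
  rw [h]
  exact hτ.comp (PowerSeries.WithPiTopology.continuous_coeff A (d ()))

/-- An element of `R⟦T₂⟧⟦T₁⟧` with zero total constant term is topologically nilpotent for the product
topology (`P = (P − C(P(0,T₂))) + C(P(0,T₂))`, both summands topologically nilpotent). [folklore] -/
theorem hasEval_of_constantCoeff₂ (P : PowerSeries (PowerSeries R))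
    (hP : PowerSeries.constantCoeff (PowerSeries.constantCoeff P) = 0) : PowerSeries.HasEval P := by
  have h1 : PowerSeries.HasEval (P - C (PowerSeries.constantCoeff P)) :=
    PowerSeries.WithPiTopology.isTopologicallyNilpotent_of_constantCoeff_zero
      (by rw [map_sub, PowerSeries.constantCoeff_C, sub_self])
  have h2 : PowerSeries.HasEval (C (PowerSeries.constantCoeff P) : PowerSeries (PowerSeries R)) :=
    IsTopologicallyNilpotent.map (φ := (C : PowerSeries R →+* PowerSeries (PowerSeries R)))
      PowerSeries.WithPiTopology.continuous_C
      (PowerSeries.WithPiTopology.isTopologicallyNilpotent_of_constantCoeff_zero hP)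
  have := h1.add h2
  rwa [sub_add_cancel] at this

/-- **Outer substitution** `F(T₁, T₂) ↦ F(P, T₁)`: the continuous ring endomorphism of `R⟦T₂⟧⟦T₁⟧` sending
the outer variable `T₁` to `P` and an inner series `f(T₂)` to `f(T₁)`, for `P` with zero total constant term
(topological evaluation `PowerSeries.eval₂` along `toOuter`). [folklore] -/
def substOuter (P : PowerSeries (PowerSeries R))
    (hP : PowerSeries.constantCoeff (PowerSeries.constantCoeff P) = 0) :
    PowerSeries (PowerSeries R) →+* PowerSeries (PowerSeries R) :=
  PowerSeries.eval₂Hom (φ := toOuter) continuous_toOuter (hasEval_of_constantCoeff₂ P hP)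

variable (P : PowerSeries (PowerSeries R)) (hP : PowerSeries.constantCoeff (PowerSeries.constantCoeff P) = 0)

/-- `substOuter P` is continuous (product topology). [folklore] -/
theorem continuous_substOuter : Continuous (substOuter P hP) := by
  rw [substOuter, PowerSeries.coe_eval₂Hom]
  exact PowerSeries.continuous_eval₂ continuous_toOuter (hasEval_of_constantCoeff₂ P hP)

/-- `substOuter P` sends `T₁ ↦ P`. [folklore] -/
theorem substOuter_X : substOuter P hP X = P := by
  rw [substOuter, PowerSeries.coe_eval₂Hom, PowerSeries.eval₂_X]

/-- `substOuter P` sends an inner series `f(T₂)` to `f(T₁)`. [folklore] -/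
theorem substOuter_C (f : PowerSeries R) : substOuter P hP (C f) = toOuter f := by
  rw [substOuter, PowerSeries.coe_eval₂Hom, PowerSeries.eval₂_C]

/-- `substOuter P` sends `T₂ ↦ T₁`. [folklore] -/
theorem substOuter_C_X : substOuter P hP (C X) = X := by
  rw [substOuter_C, toOuter_X]

/-- `substOuter P` fixes constants. [folklore] -/
theorem substOuter_C_C (c : R) : substOuter P hP (C (C c)) = C (C c) := by
  rw [substOuter_C, toOuter_C]

/-- Uniqueness of continuous ring homomorphisms out of `R⟦T₂⟧⟦T₁⟧`: determined by their values on `T₁`,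
`T₂` and the constants. [folklore] -/
theorem ringHom_ext₂_of_continuous {T : Type*} [CommRing T] [UniformSpace T] [IsUniformAddGroup T]
    [IsTopologicalRing T] [IsLinearTopology T T] [T2Space T] [CompleteSpace T]
    {ε₁ ε₂ : PowerSeries (PowerSeries R) →+* T} (h₁ : Continuous ε₁) (h₂ : Continuous ε₂)
    (hX : ε₁ X = ε₂ X) (hCX : ε₁ (C X) = ε₂ (C X)) (hCC : ∀ c : R, ε₁ (C (C c)) = ε₂ (C (C c))) :
    ε₁ = ε₂ := by
  have hc : ε₁.comp (C : PowerSeries R →+* PowerSeries (PowerSeries R)) = ε₂.comp C :=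
    ringHom_ext_of_continuous (h₁.comp PowerSeries.WithPiTopology.continuous_C)
      (h₂.comp PowerSeries.WithPiTopology.continuous_C) hCX hCC
  exact ringHom_ext_of_continuous h₁ h₂ hX fun a => by
    simpa using congrArg (fun g : PowerSeries R →+* T => g a) hc

/-- Continuity of a composite of continuous ring homomorphisms (stated on the bundled composite). -/
theorem continuous_ringHom_comp {A B T : Type*} [Semiring A] [Semiring B] [Semiring T]
    [TopologicalSpace A] [TopologicalSpace B] [TopologicalSpace T]
    {ε₁ : B →+* T} {ε₂ : A →+* B} (h₁ : Continuous ε₁) (h₂ : Continuous ε₂) : Continuous (ε₁.comp ε₂) := by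
  rw [RingHom.coe_comp]
  exact h₁.comp h₂

/-- Continuity of the identity ring homomorphism. -/
theorem continuous_ringHom_id {A : Type*} [Semiring A] [TopologicalSpace A] : Continuous (RingHom.id A) :=
  continuous_id

/-! ### The tree's swap `T₁ ↔ T₂` (`IntSeries.transpose`) is continuous -/

/-- `transpose T₂ = T₁`. [cite: deShalit1987, II.4.17 (54) (p. 78)] -/
theorem transpose_C_X : IntSeries.transpose (PowerSeries.C PowerSeries.X : PowerSeries (PowerSeries R)) = X := by
  rw [IntSeries.transpose_C, PowerSeries.map_X]

/-- `transpose` fixes constants. [cite: deShalit1987, II.4.17 (54) (p. 78)] -/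
theorem transpose_C_C (c : R) : IntSeries.transpose (C (C c) : PowerSeries (PowerSeries R)) = C (C c) := by
  rw [IntSeries.transpose_C, PowerSeries.map_C]

/-- **The swap `T₁ ↔ T₂` is continuous** for the product topology (coefficientwise it permutes coefficients).
[folklore] -/
theorem continuous_transpose :
    Continuous (IntSeries.transposeRingEquiv R : PowerSeries (PowerSeries R) → PowerSeries (PowerSeries R)) := by
  refine continuous_pi fun d => continuous_pi fun d' => ?_
  have hd : d = Finsupp.single () (d ()) := Finsupp.unique_single d
  have hd' : d' = Finsupp.single () (d' ()) := Finsupp.unique_single d'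
  have h : (fun G : PowerSeries (PowerSeries R) => (IntSeries.transposeRingEquiv R G : PowerSeries (PowerSeries R)) d d') =
      fun G => PowerSeries.coeff (d ()) (PowerSeries.coeff (d' ()) G) := by
    funext G
    conv_lhs => rw [hd, hd']
    change PowerSeries.coeff (d' ()) (PowerSeries.coeff (d ()) (IntSeries.transpose G)) = _
    rw [IntSeries.coeff_coeff_transpose]
  rw [h]
  have h1 : Continuous fun G : PowerSeries (PowerSeries R) => PowerSeries.coeff (d' ()) G :=
    PowerSeries.WithPiTopology.continuous_coeff (PowerSeries R) (d' ())
  exact (PowerSeries.WithPiTopology.continuous_coeff R (d ())).comp h1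

end Topology

end Summit.BirchSwinnertonDyer.BirchSwinnertonDyer.Theorems.UniversalToricDescentThinComb.TwoVarSubst

end
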